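import Mathlib
import HarnessLib
import Literature.Analysis.FluidPDE.TypeIAncientMildTubeAnalyticity
import Summits.NavierStokesRegularity.NavierStokesRegularity.Theorems.ChiralWindowDoorDefs
import Summits.NavierStokesRegularity.NavierStokesRegularity.Theorems.ChiralWindowDoorHomochiralProfileRigidity
import Summits.NavierStokesRegularity.NavierStokesRegularity.Theorems.LocalSineTubeDoorProfileAlignedWindowRigidityAncient

/-!
# Door S20 «ChiralWindowDoor» — K2 `ChiralProfileRigidity` PROVED OUTRIGHT; the door `Target` FROM K1 ALONE

Door S20 of nsreg-p1's local Type-I door family (`HOME/ns-regularity-ideate-p1/r19/R19-LINE.md`, texts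
`r19/Sketch20v5.lean` 7f13084196f4f031 / `r19/Sketch20v6.lean`; DESIGN-ONLY, route NOT born).  The last analytic input of
K2 — the real-analyticity of `Λ(v s)` on door-class slices, which spreads chirality from a window to the whole slice
(`…ProfileRigidityOfStubs.chiralSpread_of_sliceAnalytic`) — is the tree theorem
`Literature.Analysis.FluidPDE.analyticOnNhd_fracLaplacianHalf_of_typeI_ancient_mild` (nsreg-typer g15: Guberović 2010
uniform tube analyticity of bounded mild solutions, restarted inside the Type-I class, + "`Λ` preserves bounded tube
holomorphy", `SecondDifferenceIntegralTubeHolomorphy`).  With the residue `…HomochiralProfileRigidity.homochiralProfileRigidity`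
(this seat) every hypothesis of the planner's compositions is discharged:

* `analyticOnNhd_fracLapHalf_of_class` — `Λ(v s)` is real-analytic on `ℝ³` for every slice `s < 0` of a door-class
  profile (the substrate's `fracLapHalf` is the typer's second-difference integral by `rfl`; `C¹` slices from the
  slice analyticity `analyticOnNhd_slice`);
* `chiralProfileRigidity` — **crux K2 (rank 2) `ChiralProfileRigidity` of `r19/Sketch20v5.lean`, text verbatim, PROVED**;
  `chiralProfileRigidity_noBinder` — the binder-free v6 text, PROVED;
* `target_of_K1`, `target_of_K1noBinder` — **the door `Target` FROM THE TEXT OF K1 ALONE** (v5, resp. v6 binder-free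
  `LocalPointZoomChiralWindow`): S20's open content in the tree is exactly K1.

Seat nsreg-p6 g12 (THEOREMS-ONLY door sequels, DIRECTOR-NS g8 #32 (2)/#36); texts by nsreg-p1 g16/g17.  WHAT THIS IS
NOT: not NS regularity (Clay A); not K1 (the local CKN point zoom producing a door-class profile that is chiral on a
window — the non-local functional's passage to the limit — is untouched); K2 is a Liouville theorem for the
codimension-∞ class of window-chiral Type-I profiles; no route is opened.
-/

noncomputable section

-- the summit and its single sub-problem share the name (CONVENTIONS §1), as in every Theorems file
set_option linter.dupNamespace false

namespace Summit.NavierStokesRegularity.NavierStokesRegularity.Theorems.ChiralWindowDoorChiralProfileRigidity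

open MeasureTheory Set Function Filter Topology Metric
open scoped NNReal ENNReal RealInnerProductSpace
open Literature.Analysis Literature.Analysis.FluidPDE
open Summit.NavierStokesRegularity.NavierStokesRegularity.Theorems.ChiralWindowDoorDefs
open Summit.NavierStokesRegularity.NavierStokesRegularity.Theorems.ChiralWindowDoorHomochiralProfileRigidity
  (chiralProfileRigidity_of_sliceAnalytic chiralProfileRigidity_noBinder_of_sliceAnalytic target_of_K1_sliceAnalytic
    target_of_K1noBinder_sliceAnalytic)
open Summit.NavierStokesRegularity.NavierStokesRegularity.Theorems.LocalSineTubeDoorProfileAlignedWindowRigidityAncient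
  (analyticOnNhd_slice bdd_of_hasTypeITimeDecay)

variable {C : ℝ} {v : ℝ → EuclideanSpace ℝ (Fin 3) → EuclideanSpace ℝ (Fin 3)}

/-- **`Λ(v s)` is real-analytic on every slice `s < 0` of a door-class profile** (Type-I time rate, continuity on the
open backward slab, unit-viscosity Oseen–Duhamel identity, divergence-free slices): the typer's
`analyticOnNhd_fracLaplacianHalf_of_typeI_ancient_mild` read on the substrate's `fracLapHalf` (`rfl`). -/
theorem analyticOnNhd_fracLapHalf_of_class (hrate : HasTypeITimeDecay C v)
    (hcont : ContinuousOn (Function.uncurry v) (Set.Iio (0 : ℝ) ×ˢ Set.univ))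
    (hmild : ∀ s t : ℝ, s < t → t < 0 → ∀ x,
      v t x = UnboundedOperators.heatExtension (v s) (t - s) x - oseenDuhamel 1 s v v t x)
    (hdiv : ∀ t < 0, VectorCalculus.IsDivFree (v t)) {s : ℝ} (hs : s < 0) :
    AnalyticOnNhd ℝ (fracLapHalf (v s)) univ := by
  have hC1 : ∀ t < (0 : ℝ), ContDiff ℝ 1 (v t) := fun t ht => by
    have han := analyticOnNhd_slice hcont (bdd_of_hasTypeITimeDecay hrate) hmild ht
    exact contDiff_iff_contDiffAt.2 fun x => (han x (mem_univ x)).contDiffAt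
  have h := analyticOnNhd_fracLaplacianHalf_of_typeI_ancient_mild hrate hcont hmild hdiv hC1 hs
  have e : fracLapHalf (v s) = fun x => (1 / 2 : ℝ) • ∫ y, ((1 / Real.pi ^ 2) * (‖y‖ ^ 4)⁻¹) •
      ((2 : ℝ) • v s x - v s (x + y) - v s (x - y)) := rfl
  rw [e]
  exact h

/-- The analytic input in the shape the compositions take. -/
theorem sliceAnalytic : ∀ (C D K : ℝ) (v : ℝ → EuclideanSpace ℝ (Fin 3) → EuclideanSpace ℝ (Fin 3)),
    HasTypeITimeDecay C v → HasTypeIDecay D v → HasTypeIDerivDecay K v →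
    ContinuousOn (Function.uncurry v) (Set.Iio (0 : ℝ) ×ˢ Set.univ) →
    (∀ s t : ℝ, s < t → t < 0 → ∀ x,
        v t x = UnboundedOperators.heatExtension (v s) (t - s) x - oseenDuhamel 1 s v v t x) →
    (∀ t < 0, VectorCalculus.IsDivFree (v t)) →
    ∀ s < (0 : ℝ), AnalyticOnNhd ℝ (fracLapHalf (v s)) univ :=
  fun _C _D _K _v hrate _hdecay _hder hcont hmild hdiv _s hs => analyticOnNhd_fracLapHalf_of_class hrate hcont hmild hdiv hs

/-- **Crux K2 (rank 2) `ChiralProfileRigidity` of nsreg-p1 `r19/Sketch20v5.lean` (text verbatim over the tree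
substrate), PROVED** — chiral-on-a-window Type-I ancient mild profiles (with the R19 binder) are not backward-singular:
spread by analyticity + the residue Liouville. -/
theorem chiralProfileRigidity :
    ∀ (C D K : ℝ) (v : ℝ → EuclideanSpace ℝ (Fin 3) → EuclideanSpace ℝ (Fin 3)), Literature.Analysis.FluidPDE.HasTypeITimeDecay C v → Literature.Analysis.FluidPDE.HasTypeIDecay D v → HasTypeIDerivDecay K v → ContinuousOn (Function.uncurry v) (Set.Iio (0 : ℝ) ×ˢ Set.univ) → (∀ s t : ℝ, s < t → t < 0 → ∀ x, v t x = Literature.Analysis.UnboundedOperators.heatExtension (v s) (t - s) x - Literature.Analysis.FluidPDE.oseenDuhamel 1 s v v t x) → (∀ t < 0, Literature.Analysis.FluidPDE.VectorCalculus.IsDivFree (v t)) → (∀ s < 0, ∃ U : Set (EuclideanSpace ℝ (Fin 3)), IsOpen U ∧ U.Nonempty ∧ ∀ z ∈ U, curl (v s) z = fracLapHalf (v s) z) → ¬ Literature.Analysis.FluidPDE.IsBackwardSingularPoint v 0 :=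
  chiralProfileRigidity_of_sliceAnalytic sliceAnalytic

/-- **Crux K2 `ChiralProfileRigidity` of nsreg-p1 `r19/Sketch20v6.lean` (binder-free text, verbatim), PROVED.** -/
theorem chiralProfileRigidity_noBinder :
    ∀ (C D : ℝ) (v : ℝ → EuclideanSpace ℝ (Fin 3) → EuclideanSpace ℝ (Fin 3)), Literature.Analysis.FluidPDE.HasTypeITimeDecay C v → Literature.Analysis.FluidPDE.HasTypeIDecay D v → ContinuousOn (Function.uncurry v) (Set.Iio (0 : ℝ) ×ˢ Set.univ) → (∀ s t : ℝ, s < t → t < 0 → ∀ x, v t x = Literature.Analysis.UnboundedOperators.heatExtension (v s) (t - s) x - Literature.Analysis.FluidPDE.oseenDuhamel 1 s v v t x) → (∀ t < 0, Literature.Analysis.FluidPDE.VectorCalculus.IsDivFree (v t)) → (∀ s < 0, ∃ U : Set (EuclideanSpace ℝ (Fin 3)), IsOpen U ∧ U.Nonempty ∧ ∀ z ∈ U, Literature.Analysis.FluidPDE.curl (v s) z = Summit.NavierStokesRegularity.NavierStokesRegularity.Theorems.ChiralWindowDoorDefs.fracLapHalf (v s) z) → ¬ Literature.Analysis.FluidPDE.IsBackwardSingularPoint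 v 0 :=
  chiralProfileRigidity_noBinder_of_sliceAnalytic sliceAnalytic

/-- **The door `Target` of `r19/Sketch20v5.lean` (text verbatim) FROM THE TEXT OF K1 `LocalPointZoomChiralWindow`
ALONE** (v5, with the binder in K1's conclusion). -/
theorem target_of_K1
    (h₁ : ∀ (ν T : ℝ), 0 < ν → 0 < T → ∀ (u : ℝ → EuclideanSpace ℝ (Fin 3) → EuclideanSpace ℝ (Fin 3)) (p : ℝ → EuclideanSpace ℝ (Fin 3) → ℝ), Literature.Analysis.FluidPDE.IsClassicalNSSolutionOn (Set.Ico 0 T) ν 0 u p → Literature.Analysis.FluidPDE.IsLerayHopfOn T ν 0 (u 0) u → Literature.Analysis.FluidPDE.HasRapidSpatialDecay (u 0) → ∀ (x₀ : EuclideanSpace ℝ (Fin 3)) (ρ M : ℝ), 0 < ρ → (∀ t ∈ Set.Ico 0 T, T - ρ ^ 2 < t → ∀ x ∈ Metric.ball x₀ ρ, ‖u t x‖ * (‖x - x₀‖ + Real.sqrt (ν * (T - t))) ≤ M) → ∀ (U : Set (EuclideanSpace ℝ (Fin 3))), IsOpen U → U.Nonempty → Filter.Tendsto (fun t => ∫⁻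 y in U, ENNReal.ofReal ‖(T - t) • (curl (u t) (x₀ + Real.sqrt (T - t) • y) - fracLapHalf (u t) (x₀ + Real.sqrt (T - t) • y))‖) (nhdsWithin T (Set.Iio T)) (nhds 0) → ¬ Literature.Analysis.FluidPDE.IsBackwardBoundedAt u T x₀ → ∃ (C D K : ℝ) (v : ℝ → EuclideanSpace ℝ (Fin 3) → EuclideanSpace ℝ (Fin 3)), Literature.Analysis.FluidPDE.HasTypeITimeDecay C v ∧ Literature.Analysis.FluidPDE.HasTypeIDecay D v ∧ HasTypeIDerivDecay K v ∧ ContinuousOn (Function.uncurry v) (Set.Iio (0 : ℝ) ×ˢ Set.univ) ∧ (∀ s t : ℝ, s < t → t < 0 → ∀ x, v t x = Literature.Analysis.UnboundedOperators.heatExtension (v s) (t - s) x - Literature.Analysis.FluidPDE.oseenDuhamel 1 s v v t x) ∧ (∀ t < 0, Literature.Analysis.FluidPDE.VectorCalculus.IsDivFree (v t)) ∧ Literature.Analysis.FluidPDE.IsBackwardSingularPoint v 0 ∧ (∀ s < 0, ∃ U : Set (EuclideanSpace ℝ (Fin 3)), IsOpen U ∧ U.Nonempty ∧ ∀ z ∈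 U, curl (v s) z = fracLapHalf (v s) z)) :
    ∀ (ν T : ℝ), 0 < ν → 0 < T → ∀ (u : ℝ → EuclideanSpace ℝ (Fin 3) → EuclideanSpace ℝ (Fin 3)) (p : ℝ → EuclideanSpace ℝ (Fin 3) → ℝ), Literature.Analysis.FluidPDE.IsClassicalNSSolutionOn (Set.Ico 0 T) ν 0 u p → Literature.Analysis.FluidPDE.IsLerayHopfOn T ν 0 (u 0) u → Literature.Analysis.FluidPDE.HasRapidSpatialDecay (u 0) → ∀ (x₀ : EuclideanSpace ℝ (Fin 3)) (ρ M : ℝ), 0 < ρ → (∀ t ∈ Set.Ico 0 T, T - ρ ^ 2 < t → ∀ x ∈ Metric.ball x₀ ρ, ‖u t x‖ * (‖x - x₀‖ + Real.sqrt (ν * (T - t))) ≤ M) → ∀ (U : Set (EuclideanSpace ℝ (Fin 3))), IsOpen U → U.Nonempty → Filter.Tendsto (fun t => ∫⁻ y in U, ENNReal.ofReal ‖(T - t) • (curl (u t) (x₀ + Real.sqrt (T - t) • y) - fracLapHalf (u t) (x₀ + Real.sqrt (T - t) • y))‖) (nhdsWithin T (Set.Iio T)) (nhds 0) → Literature.Analysis.FluidPDE.IsBackwardBoundedAt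 u T x₀ :=
  target_of_K1_sliceAnalytic h₁ sliceAnalytic

/-- **The door `Target` FROM THE TEXT OF the binder-free K1 of `r19/Sketch20v6.lean` ALONE.** -/
theorem target_of_K1noBinder
    (h₁ : ∀ (ν T : ℝ), 0 < ν → 0 < T → ∀ (u : ℝ → EuclideanSpace ℝ (Fin 3) → EuclideanSpace ℝ (Fin 3)) (p : ℝ → EuclideanSpace ℝ (Fin 3) → ℝ), Literature.Analysis.FluidPDE.IsClassicalNSSolutionOn (Set.Ico 0 T) ν 0 u p → Literature.Analysis.FluidPDE.IsLerayHopfOn T ν 0 (u 0) u → Literature.Analysis.FluidPDE.HasRapidSpatialDecay (u 0) → ∀ (x₀ : EuclideanSpace ℝ (Fin 3)) (ρ M : ℝ), 0 < ρ → (∀ t ∈ Set.Ico 0 T, T - ρ ^ 2 < t → ∀ x ∈ Metric.ball x₀ ρ, ‖u t x‖ * (‖x - x₀‖ + Real.sqrt (ν * (T - t))) ≤ M) → ∀ (U : Set (EuclideanSpace ℝ (Fin 3))), IsOpen U → U.Nonempty → Filter.Tendsto (fun t => ∫⁻ y in U, ENNReal.ofReal ‖(T - t) • (Literature.Analysis.FluidPDE.curl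 (u t) (x₀ + Real.sqrt (T - t) • y) - Summit.NavierStokesRegularity.NavierStokesRegularity.Theorems.ChiralWindowDoorDefs.fracLapHalf (u t) (x₀ + Real.sqrt (T - t) • y))‖) (nhdsWithin T (Set.Iio T)) (nhds 0) → ¬ Literature.Analysis.FluidPDE.IsBackwardBoundedAt u T x₀ → ∃ (C D : ℝ) (v : ℝ → EuclideanSpace ℝ (Fin 3) → EuclideanSpace ℝ (Fin 3)), Literature.Analysis.FluidPDE.HasTypeITimeDecay C v ∧ Literature.Analysis.FluidPDE.HasTypeIDecay D v ∧ ContinuousOn (Function.uncurry v) (Set.Iio (0 : ℝ) ×ˢ Set.univ) ∧ (∀ s t : ℝ, s < t → t < 0 → ∀ x, v t x = Literature.Analysis.UnboundedOperators.heatExtension (v s) (t - s) x - Literature.Analysis.FluidPDE.oseenDuhamel 1 s v v t x) ∧ (∀ t < 0, Literature.Analysis.FluidPDE.VectorCalculus.IsDivFree (v t)) ∧ Literature.Analysis.FluidPDE.IsBackwardSingularPoint v 0 ∧ (∀ s < 0, ∃ U : Set (EuclideanSpace ℝ (Fin 3)), IsOpen U ∧ U.Nonempty ∧ ∀ z ∈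 U, Literature.Analysis.FluidPDE.curl (v s) z = Summit.NavierStokesRegularity.NavierStokesRegularity.Theorems.ChiralWindowDoorDefs.fracLapHalf (v s) z)) :
    ∀ (ν T : ℝ), 0 < ν → 0 < T → ∀ (u : ℝ → EuclideanSpace ℝ (Fin 3) → EuclideanSpace ℝ (Fin 3)) (p : ℝ → EuclideanSpace ℝ (Fin 3) → ℝ), Literature.Analysis.FluidPDE.IsClassicalNSSolutionOn (Set.Ico 0 T) ν 0 u p → Literature.Analysis.FluidPDE.IsLerayHopfOn T ν 0 (u 0) u → Literature.Analysis.FluidPDE.HasRapidSpatialDecay (u 0) → ∀ (x₀ : EuclideanSpace ℝ (Fin 3)) (ρ M : ℝ), 0 < ρ → (∀ t ∈ Set.Ico 0 T, T - ρ ^ 2 < t → ∀ x ∈ Metric.ball x₀ ρ, ‖u t x‖ * (‖x - x₀‖ + Real.sqrt (ν * (T - t))) ≤ M) → ∀ (U : Set (EuclideanSpace ℝ (Fin 3))), IsOpen U → U.Nonempty → Filter.Tendsto (fun t => ∫⁻ y in U, ENNReal.ofReal ‖(T - t) • (Literature.Analysis.FluidPDE.curl (u t) (x₀ + Real.sqrt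 (T - t) • y) - Summit.NavierStokesRegularity.NavierStokesRegularity.Theorems.ChiralWindowDoorDefs.fracLapHalf (u t) (x₀ + Real.sqrt (T - t) • y))‖) (nhdsWithin T (Set.Iio T)) (nhds 0) → Literature.Analysis.FluidPDE.IsBackwardBoundedAt u T x₀ :=
  target_of_K1noBinder_sliceAnalytic h₁ sliceAnalytic

end Summit.NavierStokesRegularity.NavierStokesRegularity.Theorems.ChiralWindowDoorChiralProfileRigidity

end
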